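/- Free lead seat `ym-line-cbag-p1` (prover-ym-line-cbag-p1-g20-0; own crux `BoxFloorAllGroups` stmt-QuantumFields-22254 of route
`ColdBoxAllGroups` CLOSED) working the planner-of-record's LINE 5, route `HankelDensitySplitting`: the ASSEMBLY item
stmt-QuantumFields-26620.  RECORD-type material (the node `LatticeNonFreezing`); the Yang–Mills mass gap is NOT proved by anything here,
and the node itself stays conditional on the two open cruxes `HankelDensityFloor` / `LogWindowMixedDominance`. -/
import Summits.QuantumFields.YangMills.Theses.HankelDensitySplitting

/-!
# Route `HankelDensitySplitting`, item `Assembly` (stmt-QuantumFields-26620):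
`HankelDensityFloor → LogWindowMixedDominance → TorusLimitTransfer → LatticeNonFreezing`

The bookkeeping implication of the route (planner ym-idea-2 g3): given `C` and a rate `μ > 0`,
* take `ε := μ/2` in `HankelDensityFloor` (constants `c, β₁`), the window data `n₁, β₂` of `LogWindowMixedDominance`, and the
  constant `K` of `TorusLimitTransfer`;
* choose `β₀` so large that for `β ≥ β₀`: `β ≥ β₁, β₂`, and with `L := log β`, `n⋆ := ⌊L²⌋₊` one has `n₁ ≤ n⋆`, `1 ≤ n⋆` and
  `2·K·C·e^{−μ n⋆} < (c/β²)·e^{−μ n⋆/2}` (`exists_threshold`; `L ≥ (2/μ)(2 + |log(2KC/c)| + μ/2)` suffices because `n⋆ > L² − 1`,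
  `two_mul_bound_lt`);
* for `β ≥ β₀`, if the node's torus witness failed beyond every `S₀`, then (taking `y = 0`, `θ₀ = id`) along infinitely many odd
  tori `|⟨F ; τ_n F⟩_{β,2S+1}| ≤ C e^{−μ n}` for all `n ≤ S`, so `TorusLimitTransfer` yields a limit state `ν` with
  `|f_ν(n)| ≤ K C e^{−μ n}` for all `n`;
* the splitting identity `f_ν(n) = t_ν(n) + g_ν(n)` (finite sums of `plaquetteCorr`; `sum_split`) with `LogWindowMixedDominance`
  (`g(n⋆−1) − 2g(n⋆) ≤ t(n⋆)`) gives `2 f_ν(n⋆) ≥ t(n⋆) + g(n⋆−1) = F_ν(n⋆) ≥ (c/β²) e^{−μ n⋆/2}` by `HankelDensityFloor`, contradicting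
  `f_ν(n⋆) ≤ K C e^{−μ n⋆}` (`no_room`).

Pure bookkeeping; no expansion and no estimate beyond `exp`/`log` arithmetic.  NOT the Yang–Mills mass gap; the node `LatticeNonFreezing`
is NOT proved here (it is the conclusion of an implication whose crux hypotheses are open).
-/

noncomputable section

open MeasureTheory Filter Topology
open Literature.MathematicalPhysics.QuantumFieldTheory
open Literature.MathematicalPhysics.QuantumLattice

namespace Summit.QuantumFields.YangMills.Theorems.HankelDensitySplitting

/-! ### The splitting identity `f = t + g` -/

/-- **Splitting of the 36-pair sum.** `Σ_{i<j, k<l} P i j k l = Σ_{0<j, k<l} P 0 j k l + Σ_{0<i<j, k<l} P i j k l` over `Fin 4`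
(the pairs with `i = 0` are the temporal plaquettes at the origin, those with `0 < i` the spatial ones). [folklore] -/
theorem sum_split (P : Fin 4 → Fin 4 → Fin 4 → Fin 4 → ℝ) :
    (∑ i : Fin 4, ∑ j : Fin 4, ∑ k : Fin 4, ∑ l : Fin 4, if i < j ∧ k < l then P i j k l else 0) =
      (∑ j : Fin 4, ∑ k : Fin 4, ∑ l : Fin 4, if 0 < j ∧ k < l then P 0 j k l else 0) +
        ∑ i : Fin 4, ∑ j : Fin 4, ∑ k : Fin 4, ∑ l : Fin 4, if 0 < i ∧ i < j ∧ k < l then P i j k l else 0 := by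
  rw [Fin.sum_univ_succ (n := 3), Fin.sum_univ_succ (n := 3)
    (f := fun i => ∑ j : Fin 4, ∑ k : Fin 4, ∑ l : Fin 4, if 0 < i ∧ i < j ∧ k < l then P i j k l else 0)]
  have h0 : (∑ j : Fin 4, ∑ k : Fin 4, ∑ l : Fin 4,
      if (0 : Fin 4) < 0 ∧ (0 : Fin 4) < j ∧ k < l then P 0 j k l else 0) = 0 := by
    simp
  rw [h0, zero_add]
  -- `0 < i.succ` is automatic: the conditions agree termwise (closed by `congr`)
  congr 1

/-! ### Arithmetic -/

/-- **No room.** The splitting `f = t + g`, the mixed dominance `g' − 2g ≤ t`, the Hankel floor `A ≤ t + g'` and the clustering bound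
`|f| ≤ B` are incompatible with `2B < A`. [folklore] -/
theorem no_room {f t g g' A B : ℝ} (hsplit : f = t + g) (hmix : g' - 2 * g ≤ t) (hfloor : A ≤ t + g')
    (hbound : |f| ≤ B) (hlt : 2 * B < A) : False := by
  have h1 : t + g' ≤ 2 * f := by rw [hsplit]; linarith
  have h2 : f ≤ B := (le_abs_self f).trans hbound
  linarith

/-- **The exponential comparison at the top of the window.** For `μ, K, c > 0`, any `C`, `L ≥ 1` with
`(2/μ)(2 + |log(2KC/c)| + μ/2) ≤ L` and a natural number `n > L² − 1`:
`2·K·C·e^{−μ n} < (c / (e^L)²)·e^{−(μ/2) n}`. [folklore] -/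
theorem two_mul_bound_lt {μ K c C L : ℝ} {n : ℕ} (hμ : 0 < μ) (hK : 0 < K) (hc : 0 < c) (hL1 : 1 ≤ L)
    (hL2 : 2 / μ * (2 + |Real.log (2 * K * C / c)| + μ / 2) ≤ L) (hn : L ^ 2 < (n : ℝ) + 1) :
    2 * (K * C * Real.exp (-(μ * n))) < c / Real.exp L ^ 2 * Real.exp (-(μ / 2 * n)) := by
  have hμ0 : μ ≠ 0 := hμ.ne'
  have hc0 : c ≠ 0 := hc.ne'
  set A : ℝ := |Real.log (2 * K * C / c)| with hA
  set E : ℝ := Real.exp (-(μ / 2 * n)) with hE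
  have hEpos : 0 < E := Real.exp_pos _
  have hβpos : 0 < Real.exp L ^ 2 := pow_pos (Real.exp_pos L) 2
  have hEE : Real.exp (-(μ * n)) = E * E := by
    rw [hE, ← Real.exp_add]; congr 1; ring
  rw [hEE]
  -- reduce to `2 K C E < c / β²`
  suffices h : 2 * K * C * E < c / Real.exp L ^ 2 by
    have := mul_lt_mul_of_pos_right h hEpos
    calc 2 * (K * C * (E * E)) = 2 * K * C * E * E := by ring
      _ < c / Real.exp L ^ 2 * E := this
  by_cases hC : C ≤ 0
  · have h1 : 2 * K * C * E ≤ 0 :=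
      mul_nonpos_of_nonpos_of_nonneg (mul_nonpos_of_nonneg_of_nonpos (by positivity) hC) hEpos.le
    exact h1.trans_lt (div_pos hc hβpos)
  · have hC : 0 < C := lt_of_not_ge hC
    -- the exponent comparison `A + 2L < (μ/2) n`
    have hA0 : 0 ≤ A := abs_nonneg _
    have h3 : 2 + A + μ / 2 ≤ μ / 2 * L := by
      have h := mul_le_mul_of_nonneg_left hL2 (half_pos hμ).le
      have e : μ / 2 * (2 / μ * (2 + A + μ / 2)) = 2 + A + μ / 2 := by
        field_simp
      linarith [h, e]
    have h4 : A + 2 * L + μ / 2 ≤ μ / 2 * L ^ 2 := by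
      have h5 : (2 + A + μ / 2) * L ≤ μ / 2 * L * L := mul_le_mul_of_nonneg_right h3 (by linarith)
      have h6 : A * 1 ≤ A * L := mul_le_mul_of_nonneg_left hL1 hA0
      have h7 : μ / 2 * 1 ≤ μ / 2 * L := mul_le_mul_of_nonneg_left hL1 (half_pos hμ).le
      have h8 : μ / 2 * L ^ 2 = μ / 2 * L * L := by ring
      have h9 : (2 + A + μ / 2) * L = 2 * L + A * L + μ / 2 * L := by ring
      linarith [h5, h6, h7, h8, h9]
    have hexp : A + 2 * L < μ / 2 * n := by
      have h6 : μ / 2 * (L ^ 2 - 1) < μ / 2 * ((n : ℝ) + 1 - 1) :=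
        mul_lt_mul_of_pos_left (by linarith) (half_pos hμ)
      have h7 : μ / 2 * (L ^ 2 - 1) = μ / 2 * L ^ 2 - μ / 2 := by ring
      have h8 : μ / 2 * ((n : ℝ) + 1 - 1) = μ / 2 * n := by ring
      linarith [h6, h7, h8, h4]
    -- exponentiate
    have hq : 0 < 2 * K * C / c := by positivity
    have h7 : 2 * K * C / c ≤ Real.exp A := by
      calc 2 * K * C / c = Real.exp (Real.log (2 * K * C / c)) := (Real.exp_log hq).symm
        _ ≤ Real.exp A := Real.exp_le_exp.2 (le_abs_self _)
    have hB : Real.exp L ^ 2 = Real.exp (2 * L) := by rw [sq, ← Real.exp_add, two_mul]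
    have h8 : Real.exp A * Real.exp L ^ 2 < Real.exp (μ / 2 * n) := by
      rw [hB, ← Real.exp_add]
      exact Real.exp_lt_exp.2 hexp
    have h9 : 2 * K * C / c * Real.exp L ^ 2 < Real.exp (μ / 2 * n) :=
      (mul_le_mul_of_nonneg_right h7 hβpos.le).trans_lt h8
    have hX : 0 < Real.exp (μ / 2 * n) := Real.exp_pos _
    have h10 : 2 * K * C * Real.exp L ^ 2 < c * Real.exp (μ / 2 * n) := by
      have h11 := mul_lt_mul_of_pos_right h9 hc
      have h12 : 2 * K * C / c * Real.exp L ^ 2 * c = 2 * K * C * Real.exp L ^ 2 := by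
        field_simp
      rw [h12] at h11
      linarith [h11]
    -- back to `E = exp((μ/2) n)⁻¹`
    have hEinv : E = (Real.exp (μ / 2 * n))⁻¹ := by rw [hE, Real.exp_neg]
    rw [hEinv, lt_div_iff₀ hβpos]
    calc 2 * K * C * (Real.exp (μ / 2 * n))⁻¹ * Real.exp L ^ 2
        = (2 * K * C * Real.exp L ^ 2) / Real.exp (μ / 2 * n) := by
          field_simp
      _ < c := by rw [div_lt_iff₀ hX]; exact h10

/-- **The `β`-threshold of the assembly.** For `μ, K, c > 0`, any `C, β₁, β₂` and `n₁`, there is `β₀` such that for all `β ≥ β₀`: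
`β ≥ β₁`, `β ≥ β₂`, `β > 0`, the window top `n⋆ = ⌊(log β)²⌋₊` satisfies `n₁ ≤ n⋆`, `1 ≤ n⋆`, and
`2·K·C·e^{−μ n⋆} < (c/β²)·e^{−(μ/2) n⋆}`. [folklore] -/
theorem exists_threshold {μ K c : ℝ} (hμ : 0 < μ) (hK : 0 < K) (hc : 0 < c) (C β₁ β₂ : ℝ) (n₁ : ℕ) :
    ∃ β₀ : ℝ, ∀ β : ℝ, β₀ ≤ β →
      β₁ ≤ β ∧ β₂ ≤ β ∧ 0 < β ∧ n₁ ≤ ⌊Real.log β ^ 2⌋₊ ∧ 1 ≤ ⌊Real.log β ^ 2⌋₊ ∧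
        2 * (K * C * Real.exp (-(μ * (⌊Real.log β ^ 2⌋₊ : ℕ)))) <
          c / β ^ 2 * Real.exp (-(μ / 2 * (⌊Real.log β ^ 2⌋₊ : ℕ))) := by
  set L₀ : ℝ := max (max 1 (n₁ : ℝ)) (2 / μ * (2 + |Real.log (2 * K * C / c)| + μ / 2)) with hL₀
  refine ⟨max (max β₁ β₂) (Real.exp L₀), fun β hβ => ?_⟩
  have hβ1 : β₁ ≤ β := ((le_max_left _ _).trans (le_max_left _ _)).trans hβ
  have hβ2 : β₂ ≤ β := ((le_max_right _ _).trans (le_max_left _ _)).trans hβ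
  have hexpβ : Real.exp L₀ ≤ β := (le_max_right _ _).trans hβ
  have hβpos : 0 < β := (Real.exp_pos _).trans_le hexpβ
  have hL : L₀ ≤ Real.log β := by
    rw [← Real.log_exp L₀]
    exact Real.log_le_log (Real.exp_pos _) hexpβ
  have hβexp : β = Real.exp (Real.log β) := (Real.exp_log hβpos).symm
  set L : ℝ := Real.log β with hLdef
  have hL1 : 1 ≤ L := ((le_max_left _ _).trans (le_max_left _ _)).trans hL
  have hLn₁ : (n₁ : ℝ) ≤ L := ((le_max_right _ _).trans (le_max_left _ _)).trans hL
  have hL2 : 2 / μ * (2 + |Real.log (2 * K * C / c)| + μ / 2) ≤ L := (le_max_right _ _).trans hL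
  have hLsq : L ≤ L ^ 2 := by nlinarith
  have hn₁ : n₁ ≤ ⌊L ^ 2⌋₊ := Nat.le_floor (hLn₁.trans hLsq)
  have h1 : 1 ≤ ⌊L ^ 2⌋₊ := Nat.le_floor (by push_cast; exact hL1.trans hLsq)
  have hlt : L ^ 2 < (⌊L ^ 2⌋₊ : ℝ) + 1 := Nat.lt_floor_add_one _
  refine ⟨hβ1, hβ2, hβpos, hn₁, h1, ?_⟩
  rw [hβexp]
  exact two_mul_bound_lt hμ hK hc hL1 hL2 hlt

/-! ### The item -/

/-- **Item stmt-QuantumFields-26620 (`Assembly`, route `HankelDensitySplitting`), proved:**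
`HankelDensityFloor → LogWindowMixedDominance → TorusLimitTransfer → LatticeNonFreezing`.  Threshold bookkeeping (`exists_threshold`),
the contrapositive at `y = 0` feeding `TorusLimitTransfer`, the splitting identity `f = t + g` of the 36-pair sum (`sum_split`) and the
final comparison at `n⋆ = ⌊(log β)²⌋₊` (`no_room`).  This is the implication only: the node `LatticeNonFreezing` remains conditional on
the route's two open cruxes; NOT the Yang–Mills mass gap. -/
theorem assembly_proof : Summit.QuantumFields.YangMills.Theses.HankelDensitySplitting.Assembly := by
  intro h₁ h₂ h₃ G _ _ _ _ hG
  letI : MeasurableSpace G := borel G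
  haveI : BorelSpace G := ⟨rfl⟩
  intro r C μ hμ
  obtain ⟨K, hK, hT⟩ := h₃ G hG r
  obtain ⟨c, β₁, hc, hfloor⟩ := h₁ G hG r (μ / 2) (half_pos hμ)
  obtain ⟨n₁, β₂, hmix⟩ := h₂ G hG r
  obtain ⟨β₀, hβ₀⟩ := exists_threshold hμ hK hc C β₁ β₂ n₁
  refine ⟨β₀, fun β hβ => ?_⟩
  obtain ⟨hβ1, hβ2, -, hn₁, h1n, hlt⟩ := hβ₀ β hβ
  by_contra hcon
  push Not at hcon
  -- at `y = 0` the node's failure is a torus clustering bound for the density with itself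
  have h0U : ∀ U : LGConfig 4 G, configShift (-(0 : Literature.Probability.LatticeModels.Site 4)) U = U := by
    intro U
    ext e
    simp [configShift_apply]
  have hyp : ∀ S₀ : ℕ, ∃ S : ℕ, S₀ ≤ S ∧ ∀ n : ℕ, n ≤ S →
      |latticeConnectedCorr r.ρ β (2 * S + 1) r.curvature.F r.curvature.F n| ≤ C * Real.exp (-(μ * n)) := by
    intro S₀
    obtain ⟨S, hS, hSall⟩ := hcon S₀
    refine ⟨S, hS, fun n hn => ?_⟩
    have h := hSall n 0 hn rfl
    simp only [h0U] at h
    exact h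
  obtain ⟨ν, hν, hbound⟩ := hT β C μ hyp
  -- the contradiction at the top of the window
  set nstar : ℕ := ⌊Real.log β ^ 2⌋₊ with hnstar
  have hnL : (nstar : ℝ) ≤ Real.log β ^ 2 := Nat.floor_le (sq_nonneg _)
  have hF := hfloor β hβ1 ν hν nstar h1n
  have hM := hmix β hβ2 ν hν nstar hn₁ hnL
  have hB := hbound nstar
  have hsplit := sum_split
    (fun i j k l => plaquetteCorr r.ρ ν 0 i j ((nstar : ℤ) • Pi.single (0 : Fin 4) (1 : ℤ)) k l)
  beta_reduce at hsplit
  exact no_room hsplit hM hF hB hlt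

end Summit.QuantumFields.YangMills.Theorems.HankelDensitySplitting

end
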